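import Mathlib
import Summits.MatrixMultiplication.MatrixMultiplication.Theses.GLnSeparatingDesigns
import Literature.NumberTheory.DiophantineGeometry.GLPolynomialRepSemisimpleProofs
import Summits.MatrixMultiplication.MatrixMultiplication.Theorems.GLnSeparatingDesignsSeparationDegreeCostBlockBound

/-!
# Translates of a split middle test span few dimensions (E2 step (ii-b), line `Ideate5Sketch`)

Stub `stub_split_finrank_span_le` (crux `BorderHalfDimensionDesigns`, stmt-MatrixMultiplication-18360): if
`p₀ ∈ ℂ[Mat_n]_{≤ s}` is left-`(H₁,χ₁)`- and right-`(H₂,χ₂)`-semi-invariant on `GL_n(ℂ)` and all such polynomials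
of degree `≤ s` lie in the span of `b` polynomials, then `dim span{R_g p₀} ≤ s^(n(n−1)/2) · b`.
Proof: `V = ℂ[Mat_n]_{≤ s}` is completely reducible under right translation (`isSemisimpleRepresentation_matTranslRep`)
with irreducible constituents of dimension `≤ s^(C(n,2))` (`stub_finrank_irreducible_le`); for the cyclic module
`N = span{R_g p₀}` and the bi-semi-invariants `SI` one shows `dim M ≤ s^(C(n,2)) · dim (SI ∩ M)` for all `M ≤ N`
by splitting off minimal subrepresentations with stable complements (`finrank_le_mul_finrank_inf_of_forall_atom`);
a minimal `W ≤ N` contains the nonzero bi-semi-invariant `W`-component of `p₀`; and `dim SI ≤ b`.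
-/

set_option linter.dupNamespace false

noncomputable section

open scoped BigOperators Matrix
open Literature.NumberTheory.DiophantineGeometry MvPolynomial

namespace Summit.MatrixMultiplication.MatrixMultiplication.Theorems.BorderHalfDimensionDesigns

/-! ## Abstract part: complemented lattices of subrepresentations -/

section Abstract

variable {G W : Type*} [Group G] [AddCommGroup W] [Module ℂ W] {ρ : Representation ℂ G W}

/-- A nonzero subrepresentation all of whose nonzero subrepresentations (of the ambient representation,
below it) coincide with it is irreducible as a representation. [folklore] -/
theorem isIrreducible_of_forall_eq (V : Subrepresentation ρ) (hV0 : V ≠ ⊥)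
    (hmin : ∀ U : Subrepresentation ρ, U ≤ V → U ≠ ⊥ → U = V) :
    V.toRepresentation.IsIrreducible := by
  -- transport a subrepresentation of `V.toRepresentation` to one of `ρ` below `V`
  have lift : ∀ U : Subrepresentation V.toRepresentation,
      ∃ U' : Subrepresentation ρ, U'.toSubmodule = U.toSubmodule.map V.toSubmodule.subtype := by
    intro U
    refine ⟨⟨U.toSubmodule.map V.toSubmodule.subtype, fun g y hy => ?_⟩, rfl⟩
    obtain ⟨u, hu, rfl⟩ := Submodule.mem_map.mp hy
    exact Submodule.mem_map.mpr ⟨V.toRepresentation g u, U.apply_mem_toSubmodule g hu, rfl⟩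
  have hbot : (⊥ : Subrepresentation V.toRepresentation).toSubmodule = ⊥ := rfl
  have htop : (⊤ : Subrepresentation V.toRepresentation).toSubmodule = ⊤ := rfl
  have hinj : Function.Injective (Submodule.map V.toSubmodule.subtype) :=
    Submodule.map_injective_of_injective V.toSubmodule.injective_subtype
  have hVne : V.toSubmodule ≠ ⊥ := fun h => hV0 (Subrepresentation.toSubmodule_injective h)
  haveI : Nontrivial (Subrepresentation V.toRepresentation) := ⟨⟨⊥, ⊤, fun h => hVne (by
    have h' := congrArg
      (fun U : Subrepresentation V.toRepresentation => U.toSubmodule.map V.toSubmodule.subtype) h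
    simp only [hbot, htop, Submodule.map_bot, Submodule.map_subtype_top] at h'
    exact h'.symm)⟩⟩
  refine ⟨fun U => ?_⟩
  obtain ⟨U', hU'⟩ := lift U
  have hU'le : U' ≤ V := by
    intro x hx
    have hx' : x ∈ U'.toSubmodule := hx
    rw [hU'] at hx'
    obtain ⟨u, -, rfl⟩ := Submodule.mem_map.mp hx'
    exact u.2
  by_cases hUb : U'.toSubmodule = ⊥
  · left
    apply Subrepresentation.toSubmodule_injective
    rw [hbot]; apply hinj; rw [← hU', hUb, Submodule.map_bot]
  · right
    apply Subrepresentation.toSubmodule_injective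
    rw [htop]; apply hinj
    have hU'V : U' = V := hmin U' hU'le (fun h => hUb (by rw [h]; rfl))
    rw [← hU', hU'V, Submodule.map_subtype_top]

variable [FiniteDimensional ℂ W]

/-- Below every nonzero subrepresentation of a finite-dimensional representation there is a minimal
nonzero one. [folklore] -/
theorem exists_minimal_le (M : Subrepresentation ρ) (hM : M ≠ ⊥) :
    ∃ V : Subrepresentation ρ, V ≤ M ∧ V ≠ ⊥ ∧ ∀ U : Subrepresentation ρ, U ≤ V → U ≠ ⊥ → U = V := by
  classical
  -- minimise the dimension over the nonzero subrepresentations below `M`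
  have hex : ∃ k, ∃ V : Subrepresentation ρ, V ≤ M ∧ V ≠ ⊥ ∧ Module.finrank ℂ V.toSubmodule = k :=
    ⟨_, M, le_rfl, hM, rfl⟩
  obtain ⟨V, hVM, hV0, hVk⟩ := Nat.find_spec hex
  refine ⟨V, hVM, hV0, fun U hUV hU0 => ?_⟩
  have hmin : Module.finrank ℂ V.toSubmodule ≤ Module.finrank ℂ U.toSubmodule := by
    rw [hVk]
    exact Nat.find_min' hex ⟨U, hUV.trans hVM, hU0, rfl⟩
  apply Subrepresentation.toSubmodule_injective
  exact Submodule.eq_of_le_of_finrank_le hUV hmin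

/-- **Dimension count in a complemented lattice of subrepresentations.**  If every irreducible
subrepresentation has dimension `≤ d`, and every minimal nonzero subrepresentation below `N` meets the
subspace `S` non-trivially, then `dim M ≤ d · dim (S ∩ M)` for every subrepresentation `M ≤ N`. [folklore] -/
theorem finrank_le_mul_finrank_inf_of_forall_atom (hc : ComplementedLattice (Subrepresentation ρ)) (d : ℕ)
    (hd : ∀ V : Subrepresentation ρ, V.toRepresentation.IsIrreducible → Module.finrank ℂ V.toSubmodule ≤ d)
    (S : Submodule ℂ W) (N : Subrepresentation ρ)
    (hA : ∀ V : Subrepresentation ρ, V ≤ N → V ≠ ⊥ →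
      (∀ U : Subrepresentation ρ, U ≤ V → U ≠ ⊥ → U = V) → S ⊓ V.toSubmodule ≠ ⊥) :
    ∀ M : Subrepresentation ρ, M ≤ N →
      Module.finrank ℂ M.toSubmodule ≤ d * Module.finrank ℂ (S ⊓ M.toSubmodule : Submodule ℂ W) := by
  -- strong induction on the dimension of `M`
  suffices h : ∀ k, ∀ M : Subrepresentation ρ, Module.finrank ℂ M.toSubmodule ≤ k → M ≤ N →
      Module.finrank ℂ M.toSubmodule ≤ d * Module.finrank ℂ (S ⊓ M.toSubmodule : Submodule ℂ W) from
    fun M hM => h _ M le_rfl hM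
  intro k
  induction k with
  | zero => intro M hk _; rw [Nat.le_zero.mp hk]; exact Nat.zero_le _
  | succ k ih =>
    intro M hk hMN
    by_cases hM0 : M = ⊥
    · subst hM0
      rw [show Module.finrank ℂ (⊥ : Subrepresentation ρ).toSubmodule = 0 from finrank_bot ℂ W]; exact Nat.zero_le _
    -- split off a minimal nonzero subrepresentation `V ≤ M` with a stable complement
    obtain ⟨V, hVM, hV0, hVmin⟩ := exists_minimal_le M hM0
    haveI := hc
    obtain ⟨C, hVC⟩ := exists_isCompl V
    -- the complement of `V` inside `M`
    set V' : Subrepresentation ρ := C ⊓ M with hV'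
    have hsup : V.toSubmodule ⊔ V'.toSubmodule = M.toSubmodule := by
      have h1 : V.toSubmodule ⊔ C.toSubmodule = ⊤ := by rw [← Subrepresentation.toSubmodule_sup, hVC.sup_eq_top]; rfl
      rw [hV', Subrepresentation.toSubmodule_inf, ← sup_inf_assoc_of_le _ (show V.toSubmodule ≤ M.toSubmodule from hVM),
        h1, top_inf_eq]
    have hinf : V.toSubmodule ⊓ V'.toSubmodule = ⊥ := by
      have h1 : V.toSubmodule ⊓ C.toSubmodule = ⊥ := by rw [← Subrepresentation.toSubmodule_inf, hVC.inf_eq_bot]; rfl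
      rw [hV', Subrepresentation.toSubmodule_inf, ← inf_assoc, h1, bot_inf_eq]
    have hdim : Module.finrank ℂ M.toSubmodule =
        Module.finrank ℂ V.toSubmodule + Module.finrank ℂ V'.toSubmodule := by
      have := Submodule.finrank_sup_add_finrank_inf_eq V.toSubmodule V'.toSubmodule
      rw [hsup, hinf, finrank_bot, add_zero] at this
      exact this
    -- `V` is irreducible, hence small
    have hVd : Module.finrank ℂ V.toSubmodule ≤ d := hd V (isIrreducible_of_forall_eq V hV0 hVmin)
    -- `V` has positive dimension, so the induction hypothesis applies to `V'`
    have hVpos : 0 < Module.finrank ℂ V.toSubmodule := by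
      rw [Module.finrank_pos_iff_exists_ne_zero]
      have hne : V.toSubmodule ≠ ⊥ := fun h => hV0 (Subrepresentation.toSubmodule_injective h)
      obtain ⟨v, hv, hv0⟩ := Submodule.exists_mem_ne_zero_of_ne_bot hne
      exact ⟨⟨v, hv⟩, fun h => hv0 (congrArg Subtype.val h)⟩
    have hV'N : V' ≤ N := (inf_le_right : V' ≤ M).trans hMN
    have hV'k : Module.finrank ℂ V'.toSubmodule ≤ k := by omega
    have ihV' := ih V' hV'k hV'N
    -- `V` meets `S`
    have hSV : 1 ≤ Module.finrank ℂ (S ⊓ V.toSubmodule : Submodule ℂ W) := by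
      rw [Nat.one_le_iff_ne_zero, Ne, Submodule.finrank_eq_zero]
      exact hA V (hVM.trans hMN) hV0 hVmin
    -- additivity of the `S`-parts
    have hSadd : Module.finrank ℂ (S ⊓ V.toSubmodule : Submodule ℂ W) +
        Module.finrank ℂ (S ⊓ V'.toSubmodule : Submodule ℂ W) ≤
        Module.finrank ℂ (S ⊓ M.toSubmodule : Submodule ℂ W) := by
      have h1 := Submodule.finrank_sup_add_finrank_inf_eq (S ⊓ V.toSubmodule) (S ⊓ V'.toSubmodule)
      have h2 : (S ⊓ V.toSubmodule) ⊓ (S ⊓ V'.toSubmodule) = ⊥ := by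
        rw [eq_bot_iff, ← hinf]
        exact le_inf (inf_le_left.trans inf_le_right) (inf_le_right.trans inf_le_right)
      have h3 : (S ⊓ V.toSubmodule) ⊔ (S ⊓ V'.toSubmodule) ≤ S ⊓ M.toSubmodule := by
        rw [← hsup]
        exact sup_le (inf_le_inf_left _ le_sup_left) (inf_le_inf_left _ le_sup_right)
      rw [h2, finrank_bot, add_zero] at h1
      rw [← h1]
      exact Submodule.finrank_mono h3
    -- combine
    rw [hdim]
    calc Module.finrank ℂ V.toSubmodule + Module.finrank ℂ V'.toSubmodule
        ≤ d * 1 + d * Module.finrank ℂ (S ⊓ V'.toSubmodule : Submodule ℂ W) := by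
          rw [mul_one]; exact Nat.add_le_add hVd ihV'
      _ ≤ d * Module.finrank ℂ (S ⊓ V.toSubmodule : Submodule ℂ W) +
          d * Module.finrank ℂ (S ⊓ V'.toSubmodule : Submodule ℂ W) :=
          Nat.add_le_add_right (Nat.mul_le_mul_left d hSV) _
      _ = d * (Module.finrank ℂ (S ⊓ V.toSubmodule : Submodule ℂ W) +
          Module.finrank ℂ (S ⊓ V'.toSubmodule : Submodule ℂ W)) := (Nat.mul_add _ _ _).symm
      _ ≤ d * Module.finrank ℂ (S ⊓ M.toSubmodule : Submodule ℂ W) := Nat.mul_le_mul_left d hSadd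

end Abstract

/-! ## Concrete part: right translation on `ℂ[Mat_n]_{≤ s}` -/

section Concrete

/-- `(R_g P)(w) = P(w g)` for `w, g ∈ GL_n`. [folklore] -/
theorem splitSpan_eval_matTransl {n : ℕ} (w g : Matrix.GeneralLinearGroup (Fin n) ℂ)
    (P : MvPolynomial (Fin n × Fin n) ℂ) :
    MvPolynomial.eval (fun ij : Fin n × Fin n => (w : Matrix (Fin n) (Fin n) ℂ) ij.1 ij.2)
        (matTransl (Fin n) ℂ (g : Matrix (Fin n) (Fin n) ℂ) P) =
      MvPolynomial.eval (fun ij : Fin n × Fin n =>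
        ((w * g : Matrix.GeneralLinearGroup (Fin n) ℂ) : Matrix (Fin n) (Fin n) ℂ) ij.1 ij.2) P := by
  rw [eval_matTransl]
  simp only [Units.val_mul, Matrix.mul_apply]

/-- **Stub (ii-b) of E2 — translates of a split middle test span few dimensions**: a bi-semi-invariant
`p₀` of degree `≤ s` whose kind is spanned by `b` polynomials has `dim span{R_g p₀} ≤ s^(n(n−1)/2) · b`. [folklore] -/
theorem stub_split_finrank_span_le {n s b : ℕ} (hn : 3 ≤ n) (hs : 2 ≤ s)
    (H₁ H₂ : Subgroup (Matrix.GeneralLinearGroup (Fin n) ℂ)) (χ₁ χ₂ : Matrix.GeneralLinearGroup (Fin n) ℂ → ℂ)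
    (g : Fin b → MvPolynomial (Fin n × Fin n) ℂ)
    (hspan : ∀ p : MvPolynomial (Fin n × Fin n) ℂ, p.totalDegree ≤ s →
      (∀ h ∈ H₁, ∀ w : Matrix.GeneralLinearGroup (Fin n) ℂ,
        MvPolynomial.eval (fun ij : Fin n × Fin n =>
          ((h * w : Matrix.GeneralLinearGroup (Fin n) ℂ) : Matrix (Fin n) (Fin n) ℂ) ij.1 ij.2) p =
        χ₁ h * MvPolynomial.eval (fun ij : Fin n × Fin n => (w : Matrix (Fin n) (Fin n) ℂ) ij.1 ij.2) p) →
      (∀ h ∈ H₂, ∀ w : Matrix.GeneralLinearGroup (Fin n) ℂ,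
        MvPolynomial.eval (fun ij : Fin n × Fin n =>
          ((w * h : Matrix.GeneralLinearGroup (Fin n) ℂ) : Matrix (Fin n) (Fin n) ℂ) ij.1 ij.2) p =
        χ₂ h * MvPolynomial.eval (fun ij : Fin n × Fin n => (w : Matrix (Fin n) (Fin n) ℂ) ij.1 ij.2) p) →
      p ∈ Submodule.span ℂ (Set.range g))
    (p₀ : MvPolynomial (Fin n × Fin n) ℂ) (hp₀ : p₀.totalDegree ≤ s)
    (hleft : ∀ h ∈ H₁, ∀ w : Matrix.GeneralLinearGroup (Fin n) ℂ,
      MvPolynomial.eval (fun ij : Fin n × Fin n =>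
        ((h * w : Matrix.GeneralLinearGroup (Fin n) ℂ) : Matrix (Fin n) (Fin n) ℂ) ij.1 ij.2) p₀ =
      χ₁ h * MvPolynomial.eval (fun ij : Fin n × Fin n => (w : Matrix (Fin n) (Fin n) ℂ) ij.1 ij.2) p₀)
    (hright : ∀ h ∈ H₂, ∀ w : Matrix.GeneralLinearGroup (Fin n) ℂ,
      MvPolynomial.eval (fun ij : Fin n × Fin n =>
        ((w * h : Matrix.GeneralLinearGroup (Fin n) ℂ) : Matrix (Fin n) (Fin n) ℂ) ij.1 ij.2) p₀ =
      χ₂ h * MvPolynomial.eval (fun ij : Fin n × Fin n => (w : Matrix (Fin n) (Fin n) ℂ) ij.1 ij.2) p₀) :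
    Module.finrank ℂ (Submodule.span ℂ (Set.range fun g : Matrix.GeneralLinearGroup (Fin n) ℂ =>
      matTransl (Fin n) ℂ (g : Matrix (Fin n) (Fin n) ℂ) p₀)) ≤ s ^ (n * (n - 1) / 2) * b := by
  classical
  -- the host `V = ℂ[Mat_n]_{≤ s}` as a subrepresentation of right translation
  let ρ : Representation ℂ (Matrix.GeneralLinearGroup (Fin n) ℂ) (MvPolynomial (Fin n × Fin n) ℂ) :=
    matTranslRep (Fin n) ℂ
  let V : Subrepresentation ρ :=
    ⟨restrictTotalDegree (Fin n × Fin n) ℂ s, fun g' p hp => by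
      rw [mem_restrictTotalDegree] at hp ⊢
      exact (totalDegree_matTransl_le _ p).trans hp⟩
  have hV : ∀ p, p ∈ V.toSubmodule ↔ p.totalDegree ≤ s := fun p => mem_restrictTotalDegree _ _ p
  haveI hfd : FiniteDimensional ℂ V.toSubmodule := by
    change FiniteDimensional ℂ (restrictTotalDegree (Fin n × Fin n) ℂ s)
    infer_instance
  let ρV := V.toRepresentation
  have hss : ρV.IsSemisimpleRepresentation :=
    isSemisimpleRepresentation_toRepresentation V isSemisimpleRepresentation_matTranslRep
  have hρV : ∀ (g' : Matrix.GeneralLinearGroup (Fin n) ℂ) (v : V.toSubmodule),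
      ((ρV g' v : V.toSubmodule) : MvPolynomial (Fin n × Fin n) ℂ) =
        matTransl (Fin n) ℂ (g' : Matrix (Fin n) (Fin n) ℂ) (v : MvPolynomial (Fin n × Fin n) ℂ) :=
    fun _ _ => rfl
  -- the generator and its cyclic module
  let p₀V : V.toSubmodule := ⟨p₀, (hV p₀).2 hp₀⟩
  let N : Submodule ℂ V.toSubmodule :=
    Submodule.span ℂ (Set.range fun g' : Matrix.GeneralLinearGroup (Fin n) ℂ => ρV g' p₀V)
  have hNstab : ∀ (g' : Matrix.GeneralLinearGroup (Fin n) ℂ), ∀ v ∈ N, ρV g' v ∈ N := by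
    intro g' v hv
    have hle : N ≤ N.comap (ρV g') := by
      rw [Submodule.span_le]
      rintro _ ⟨g'', rfl⟩
      simp only [SetLike.mem_coe, Submodule.mem_comap]
      rw [← Module.End.mul_apply, ← map_mul]
      exact Submodule.subset_span ⟨g' * g'', rfl⟩
    exact hle hv
  let NV : Subrepresentation ρV := ⟨N, fun g' v hv => hNstab g' v hv⟩
  have hp₀N : p₀V ∈ N := by
    have : ρV 1 p₀V = p₀V := by rw [map_one]; rfl
    rw [← this]
    exact Submodule.subset_span ⟨1, rfl⟩
  -- everything in `N` is left-semi-invariant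
  have hNleft : ∀ v ∈ N, ∀ h ∈ H₁, ∀ w : Matrix.GeneralLinearGroup (Fin n) ℂ,
      MvPolynomial.eval (fun ij : Fin n × Fin n =>
        ((h * w : Matrix.GeneralLinearGroup (Fin n) ℂ) : Matrix (Fin n) (Fin n) ℂ) ij.1 ij.2)
          (v : MvPolynomial (Fin n × Fin n) ℂ) =
      χ₁ h * MvPolynomial.eval (fun ij : Fin n × Fin n => (w : Matrix (Fin n) (Fin n) ℂ) ij.1 ij.2)
          (v : MvPolynomial (Fin n × Fin n) ℂ) := by
    intro v hv
    induction hv using Submodule.span_induction with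
    | mem x hx =>
      obtain ⟨g', rfl⟩ := hx
      intro h hh w
      rw [hρV, splitSpan_eval_matTransl, splitSpan_eval_matTransl, mul_assoc, hleft h hh (w * g')]
    | zero => intro h _ w; simp
    | add x y _ _ hx hy =>
      intro h hh w
      rw [Submodule.coe_add, map_add, map_add, hx h hh w, hy h hh w, mul_add]
    | smul c x _ hx =>
      intro h hh w
      rw [Submodule.coe_smul, smul_eval, smul_eval, hx h hh w]
      ring
  -- the right action of `H₂` on `p₀` is scalar
  have hRp₀ : ∀ h ∈ H₂, ρV h p₀V = χ₂ h • p₀V := by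
    intro h hh
    apply Subtype.ext
    rw [hρV, Submodule.coe_smul]
    refine MvPolynomial.eq_of_eval_eq_on_gl fun w => ?_
    rw [splitSpan_eval_matTransl, hright h hh w, smul_eval]
  -- the bi-semi-invariant vectors of `V`
  let SIV : Submodule ℂ V.toSubmodule :=
    { carrier := {v | (∀ h ∈ H₁, ∀ w : Matrix.GeneralLinearGroup (Fin n) ℂ,
          MvPolynomial.eval (fun ij : Fin n × Fin n =>
            ((h * w : Matrix.GeneralLinearGroup (Fin n) ℂ) : Matrix (Fin n) (Fin n) ℂ) ij.1 ij.2)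
              (v : MvPolynomial (Fin n × Fin n) ℂ) =
          χ₁ h * MvPolynomial.eval (fun ij : Fin n × Fin n => (w : Matrix (Fin n) (Fin n) ℂ) ij.1 ij.2)
              (v : MvPolynomial (Fin n × Fin n) ℂ)) ∧
        (∀ h ∈ H₂, ∀ w : Matrix.GeneralLinearGroup (Fin n) ℂ,
          MvPolynomial.eval (fun ij : Fin n × Fin n =>
            ((w * h : Matrix.GeneralLinearGroup (Fin n) ℂ) : Matrix (Fin n) (Fin n) ℂ) ij.1 ij.2)
              (v : MvPolynomial (Fin n × Fin n) ℂ) =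
          χ₂ h * MvPolynomial.eval (fun ij : Fin n × Fin n => (w : Matrix (Fin n) (Fin n) ℂ) ij.1 ij.2)
              (v : MvPolynomial (Fin n × Fin n) ℂ))}
      add_mem' := by
        rintro x y ⟨hx1, hx2⟩ ⟨hy1, hy2⟩
        refine ⟨fun h hh w => ?_, fun h hh w => ?_⟩
        · rw [Submodule.coe_add, map_add, map_add, hx1 h hh w, hy1 h hh w, mul_add]
        · rw [Submodule.coe_add, map_add, map_add, hx2 h hh w, hy2 h hh w, mul_add]
      zero_mem' := ⟨fun h _ w => by simp, fun h _ w => by simp⟩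
      smul_mem' := by
        rintro c x ⟨hx1, hx2⟩
        refine ⟨fun h hh w => ?_, fun h hh w => ?_⟩
        · rw [Submodule.coe_smul, smul_eval, smul_eval, hx1 h hh w]; ring
        · rw [Submodule.coe_smul, smul_eval, smul_eval, hx2 h hh w]; ring }
  -- `dim SIV ≤ b`
  have hSIVb : Module.finrank ℂ SIV ≤ b := by
    haveI : FiniteDimensional ℂ (Submodule.span ℂ (Set.range g)) :=
      FiniteDimensional.span_of_finite ℂ (Set.finite_range g)
    have hle : SIV.map V.toSubmodule.subtype ≤ Submodule.span ℂ (Set.range g) := by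
      rintro _ ⟨v, ⟨hv1, hv2⟩, rfl⟩
      exact hspan _ ((hV _).1 v.2) hv1 hv2
    calc Module.finrank ℂ SIV = Module.finrank ℂ (SIV.map V.toSubmodule.subtype) :=
          (Submodule.finrank_map_subtype_eq V.toSubmodule SIV).symm
      _ ≤ Module.finrank ℂ (Submodule.span ℂ (Set.range g)) := Submodule.finrank_mono hle
      _ ≤ Fintype.card (Fin b) := finrank_range_le_card g
      _ = b := Fintype.card_fin b
  -- irreducible constituents are small (BCGPU Lemma 2.7, tree)
  have hd : ∀ W' : Subrepresentation ρV, IsSimpleOrder (Subrepresentation W'.toRepresentation) →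
      Module.finrank ℂ W'.toSubmodule ≤ s ^ (n * (n - 1) / 2) := by
    intro W' hW'
    exact stub_finrank_irreducible_le hn hs V hV W' hW'
  -- Lemma A: every minimal nonzero subrepresentation below `NV` meets `SIV`
  have hA : ∀ W' : Subrepresentation ρV, W' ≤ NV → W' ≠ ⊥ →
      (∀ U : Subrepresentation ρV, U ≤ W' → U ≠ ⊥ → U = W') → SIV ⊓ W'.toSubmodule ≠ ⊥ := by
    intro W' hW'N hW'0 _
    haveI := hss
    obtain ⟨C, hWC⟩ := exists_isCompl W'
    -- complement of `W'` inside `NV`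
    have hsup : W'.toSubmodule ⊔ (C ⊓ NV).toSubmodule = N := by
      have h1 : W'.toSubmodule ⊔ C.toSubmodule = ⊤ := by rw [← Subrepresentation.toSubmodule_sup, hWC.sup_eq_top]; rfl
      rw [Subrepresentation.toSubmodule_inf, ← sup_inf_assoc_of_le _ (show W'.toSubmodule ≤ NV.toSubmodule from hW'N),
        h1, top_inf_eq]
    have hinf : W'.toSubmodule ⊓ (C ⊓ NV).toSubmodule = ⊥ := by
      have h1 : W'.toSubmodule ⊓ C.toSubmodule = ⊥ := by rw [← Subrepresentation.toSubmodule_inf, hWC.inf_eq_bot]; rfl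
      rw [Subrepresentation.toSubmodule_inf, ← inf_assoc, h1, bot_inf_eq]
    -- decompose the generator
    have hp₀' : p₀V ∈ W'.toSubmodule ⊔ (C ⊓ NV).toSubmodule := by rw [hsup]; exact hp₀N
    obtain ⟨w, hw, w'', hw'', hsum⟩ := Submodule.mem_sup.mp hp₀'
    -- `w ≠ 0`
    have hw0 : w ≠ 0 := by
      intro hw0
      rw [hw0, zero_add] at hsum
      -- then `p₀ ∈ C ⊓ NV`, a subrepresentation, so `N ≤ C ⊓ NV` and `W' ≤ W' ⊓ (C ⊓ NV) = ⊥`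
      have hNle : N ≤ (C ⊓ NV).toSubmodule := by
        rw [Submodule.span_le]
        rintro _ ⟨g', rfl⟩
        rw [← hsum]
        exact (C ⊓ NV).apply_mem_toSubmodule g' hw''
      apply hW'0
      apply Subrepresentation.toSubmodule_injective
      have h1 : W'.toSubmodule ≤ W'.toSubmodule ⊓ (C ⊓ NV).toSubmodule :=
        le_inf le_rfl ((show W'.toSubmodule ≤ N from hW'N).trans hNle)
      rw [hinf] at h1
      exact le_bot_iff.mp h1
    -- `w` is right-semi-invariant: uniqueness of the decomposition
    have hRw : ∀ h ∈ H₂, ρV h w = χ₂ h • w := by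
      intro h hh
      have e1 : ρV h p₀V = ρV h w + ρV h w'' := by rw [← hsum, map_add]
      have e2 : ρV h p₀V = χ₂ h • w + χ₂ h • w'' := by rw [hRp₀ h hh, ← hsum, smul_add]
      have hx1 : ρV h w - χ₂ h • w ∈ W'.toSubmodule :=
        Submodule.sub_mem _ (W'.apply_mem_toSubmodule h hw) (Submodule.smul_mem _ _ hw)
      have hx2 : ρV h w - χ₂ h • w ∈ (C ⊓ NV).toSubmodule := by
        have e3 : ρV h w - χ₂ h • w = χ₂ h • w'' - ρV h w'' := by
          have := e1.symm.trans e2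
          -- `a + b = c + d` with `a - c = d - b`
          calc ρV h w - χ₂ h • w = (ρV h w + ρV h w'') - ρV h w'' - χ₂ h • w := by abel
            _ = (χ₂ h • w + χ₂ h • w'') - ρV h w'' - χ₂ h • w := by rw [this]
            _ = χ₂ h • w'' - ρV h w'' := by abel
        rw [e3]
        exact Submodule.sub_mem _ (Submodule.smul_mem _ _ hw'') ((C ⊓ NV).apply_mem_toSubmodule h hw'')
      have hx : ρV h w - χ₂ h • w ∈ W'.toSubmodule ⊓ (C ⊓ NV).toSubmodule := ⟨hx1, hx2⟩
      rw [hinf, Submodule.mem_bot] at hx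
      exact sub_eq_zero.mp hx
    -- hence `w ∈ SIV`
    have hwS : w ∈ SIV := by
      refine ⟨hNleft w ((show W'.toSubmodule ≤ N from hW'N) hw), fun h hh w₀ => ?_⟩
      rw [← splitSpan_eval_matTransl, ← hρV, hRw h hh, Submodule.coe_smul, smul_eval]
    intro hbot
    have : w ∈ SIV ⊓ W'.toSubmodule := ⟨hwS, hw⟩
    rw [hbot, Submodule.mem_bot] at this
    exact hw0 this
  -- the dimension count
  have hmain := finrank_le_mul_finrank_inf_of_forall_atom hss (s ^ (n * (n - 1) / 2)) hd SIV NV hA NV le_rfl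
  -- identify the span in the statement with `N`
  have hspanN : Submodule.span ℂ (Set.range fun g' : Matrix.GeneralLinearGroup (Fin n) ℂ =>
      matTransl (Fin n) ℂ (g' : Matrix (Fin n) (Fin n) ℂ) p₀) = N.map V.toSubmodule.subtype := by
    rw [Submodule.map_span, ← Set.range_comp]
    rfl
  rw [hspanN, Submodule.finrank_map_subtype_eq]
  calc Module.finrank ℂ N
      ≤ s ^ (n * (n - 1) / 2) * Module.finrank ℂ (SIV ⊓ NV.toSubmodule : Submodule ℂ V.toSubmodule) := hmain
    _ ≤ s ^ (n * (n - 1) / 2) * Module.finrank ℂ SIV :=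
        Nat.mul_le_mul_left _ (Submodule.finrank_mono inf_le_left)
    _ ≤ s ^ (n * (n - 1) / 2) * b := Nat.mul_le_mul_left _ hSIVb

end Concrete

end Summit.MatrixMultiplication.MatrixMultiplication.Theorems.BorderHalfDimensionDesigns
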